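import Literature.AlgebraicGeometry.Resolution.DecompletionEtaleCoordinates
import Literature.AlgebraicGeometry.Resolution.ValuedFunctionFieldsLemmas
import Mathlib.RingTheory.Unramified.LocalStructure
import HarnessLib

/-!
# Temkin's decompletion lemma, algebraic proof — I. The étale chart at the point (core)

Topic: `Literature/AlgebraicGeometry/Resolution`. M. Temkin, *Inseparable local uniformization*,
J. Algebra 373 (2013) 65–119 = arXiv:0804.1554v3, Lemma 3.3.2 (tree: the corrected rendering
`Temkin2013_Lemma332_nft`, `InseparableLocalUniformizationDecompletion.lean`). The printed proof
is Berkovich-analytic; its first step reads (p. 45): "we obtain a character `𝒜 → m̂` which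
gives rise to a smooth `m̂`-point `x̂ ∈ 𝔛_η` … Let `T = (T₁, …, T_n)` be a system of regular
parameters of `𝒪_{𝔛_η,x̂}`. The morphism `U → 𝐀ⁿ_k̂`, which `T` induces on a sufficiently small
affinoid neighborhood of `x̂`, is étale at `x̂`". This file provides the finite-level, purely
algebraic counterpart used by the algebraic proof of the lemma carried out in this series:

* `exists_away_mul` — book-keeping: localizing a localization away from an element is
  localizing away from a product (the first conjunct is Mathlib's
  `IsLocalization.Away.mul_of_associated`/`mul'`; we also record the explicit relation) — PROVED.
* The localization `R[1/h] ⊆ K` is the tree's `locAway R h hhR`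
  (`ValuedFunctionFieldsLemmas.lean`: `z ∈ R[1/h] ↔ z hᴺ ∈ R`, `isLocalization_locAway`).
* `exists_chart_core` — **the étale chart at the point**: for a finitely generated
  `k`-subalgebra `R ⊆ K`, a closed point `φ : R → m` onto a field separable over `k` at which
  `R` is smooth over `k`, there are `h ∈ R` with `φ(h) = 1`, the extension `φh` of `φ` to
  `R[1/h]`, coordinates `T₁, …, T_n ∈ R[1/h]` with `φh(Tᵢ) = 0`, and a STANDARD ÉTALE
  presentation of `R[1/h]` over `k[X₁, …, X_n]`, `Xᵢ ↦ Tᵢ` — PROVED, from Mathlib's local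
  structure theorem `Algebra.IsSmoothAt.exists_isStandardEtale_mvPolynomial` (Stacks 054L),
  `etale_minpolyCoordMap` (`DecompletionEtaleCoordinates.lean`, making the coordinates vanish
  at the point, where separability of `m/k` enters), `Algebra.IsEtaleAt.exists_isStandardEtale`
  (Stacks 00UE), a final localization normalizing `φ(h)` to `1`, and transport to `K`.

All statements are [folklore]; no named facts.

## Sources

* M. Temkin, arXiv:0804.1554v3, Lemma 3.3.2 and its proof (pp. 45–46).
* The Stacks Project, Tags 054L, 00UE (through Mathlib).
-/

noncomputable section

open Polynomial

namespace Literature.AlgebraicGeometry.Resolution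

universe u

variable {k K m : Type u} [Field k] [Field K] [Algebra k K] [Field m] [Algebra k m]

/-! ### Book-keeping for iterated localizations -/

/-- Localizing a localization away from an element is localizing away from a product: in a
localization `S` of `R` away from `f`, every `y ∈ S` is `r / fᵃ`, and `S[1/y]` is the
localization of `R` away from `f·r`. [folklore] -/
theorem exists_away_mul {R S : Type*} [CommRing R] [CommRing S] [Algebra R S] (f : R)
    [IsLocalization.Away f S] (y : S) (Sy : Type*) [CommRing Sy] [Algebra S Sy]
    [Algebra R Sy] [IsScalarTower R S Sy] [IsLocalization.Away y Sy] :
    ∃ (r : R) (a : ℕ), IsLocalization.Away (f * r) Sy ∧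
      algebraMap R S r = y * algebraMap R S f ^ a := by
  obtain ⟨r, s, hr⟩ := IsLocalization.exists_mk'_eq (.powers f) y
  obtain ⟨a, ha⟩ := s.2
  have hspec := IsLocalization.mk'_spec' S r s
  rw [hr] at hspec
  have hs : algebraMap R S s = algebraMap R S f ^ a := by
    rw [← map_pow]; exact congrArg _ ha.symm
  refine ⟨r, a, ?_, ?_⟩
  · have hassoc : Associated y (algebraMap R S r) := by
      refine ⟨(IsLocalization.Away.algebraMap_pow_isUnit f a).unit, ?_⟩
      rw [IsUnit.unit_spec, ← hs, mul_comm, hspec]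
    haveI : IsLocalization.Away (algebraMap R S r) Sy := IsLocalization.Away.of_associated hassoc
    exact IsLocalization.Away.mul' S Sy f r
  · rw [← hspec, hs, mul_comm]

-- The construction chains six localizations/transports with many local instances; the
-- default heartbeat budget does not suffice for the final instance unification.
set_option maxHeartbeats 800000 in
/-- **Core of the chart construction**: for a finitely generated `k`-subalgebra `R ⊆ K`, a
closed point `φ : R → m` with `m/k` separable at which `R` is smooth, there are a denominator
`h ∈ R` with `φ(h) = 1`, the localization `Rh = R[1/h] ⊆ K` with the extension `φh` of `φ`,
étale coordinates `T₁, …, T_n ∈ Rh` vanishing at the point, and a standard étale presentation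
of `Rh` over `k[X₁, …, X_n]`, `Xᵢ ↦ Tᵢ`. [folklore] -/
theorem exists_chart_core (R : Subalgebra k K) [Algebra.FiniteType k R]
    (φ : R →ₐ[k] m) (hφ : Function.Surjective φ) [Algebra.IsSeparable k m]
    (x : Ideal R) [x.IsPrime] (hker : RingHom.ker (φ : R →+* m) = x)
    (hsm : Algebra.IsSmoothAt k x) :
    ∃ (h : K) (hhR : h ∈ R), φ ⟨h, hhR⟩ = 1 ∧
    ∃ (φh : locAway R h hhR →ₐ[k] m),
      (∀ (r : R) (hr : (r : K) ∈ locAway R h hhR), φh ⟨r, hr⟩ = φ r) ∧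
    ∃ (n : ℕ) (T : Fin n → K) (hT : ∀ i, T i ∈ locAway R h hhR),
      (∀ i, φh ⟨T i, hT i⟩ = 0) ∧
      letI := (MvPolynomial.aeval (R := k)
        (fun i => (⟨T i, hT i⟩ : locAway R h hhR))).toAlgebra
      Algebra.IsStandardEtale (MvPolynomial (Fin n) k) (locAway R h hhR) := by
  classical
  -- `φ(r) ≠ 0` off the point
  have hφne : ∀ r : R, r ∉ x → φ r ≠ 0 := fun r hr h0 => hr (by
    rw [← hker]; exact h0)
  have hmemx : ∀ r : R, φ r = 0 → r ∈ x := fun r h0 => by rw [← hker]; exact h0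
  haveI : Algebra.FinitePresentation k R :=
    (Algebra.FinitePresentation.of_finiteType (R := k) (A := R)).mp inferInstance
  -- Step 4: Mathlib's local structure of smooth algebras
  haveI := hsm
  obtain ⟨f₁, hf₁x, n, algInst, hst, hstd⟩ :=
    Algebra.IsSmoothAt.exists_isStandardEtale_mvPolynomial (R := k) (p := x)
  let B := MvPolynomial (Fin n) k
  let S₀ := Localization.Away f₁
  letI : Algebra B S₀ := algInst
  haveI : IsScalarTower k B S₀ := hst
  haveI : Algebra.IsStandardEtale B S₀ := hstd
  -- the point on `S₀`
  have hf₁u : IsUnit (φ f₁) := (hφne f₁ hf₁x).isUnit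
  let φ₀ : S₀ →ₐ[k] m := IsLocalization.Away.liftAlgHom f₁ (f := φ) hf₁u
  have hφ₀ : ∀ r : R, φ₀ (algebraMap R S₀ r) = φ r := fun r =>
    IsLocalization.Away.lift_eq f₁ hf₁u r
  let t : Fin n → m := fun i => φ₀ (algebraMap B S₀ (MvPolynomial.X i))
  have hφ₀B : ∀ q : B, φ₀ (algebraMap B S₀ q) = MvPolynomial.aeval (R := k) t q := by
    intro q
    have : (φ₀.comp (IsScalarTower.toAlgHom k B S₀)) = MvPolynomial.aeval (R := k) t :=
      MvPolynomial.algHom_ext fun i => by rw [MvPolynomial.aeval_X]; rfl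
    exact congr($this q)
  have hsep : ∀ i, IsSeparable k (t i) := fun i => Algebra.IsSeparable.isSeparable k (t i)
  -- Step 5: étale coordinates vanishing at the point
  let D : S₀ := minpolyCoordDen (S₀ := S₀) k t
  let S₁ := Localization.Away D
  let ψ : B →+* S₁ := minpolyCoordMap (S₀ := S₀) k t
  have hψ : ψ.Etale := etale_minpolyCoordMap (S₀ := S₀) k t
  have hDne : φ₀ D ≠ 0 := eval_minpolyCoordDen_ne_zero k t φ₀.toRingHom hφ₀B hsep
  let φ₁ : S₁ →ₐ[k] m := IsLocalization.Away.liftAlgHom D (f := φ₀) hDne.isUnit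
  have hφ₁ : ∀ z : S₀, φ₁ (algebraMap S₀ S₁ z) = φ₀ z := fun z =>
    IsLocalization.Away.lift_eq D hDne.isUnit z
  let T₁ : Fin n → S₁ := fun i => algebraMap S₀ S₁ (minpolyCoord (S₀ := S₀) k t i)
  have hψX : ∀ i, ψ (MvPolynomial.X i) = T₁ i := fun i => minpolyCoordMap_X k t i
  have hψC : ∀ c, ψ (MvPolynomial.C c) = algebraMap k S₁ c := fun c => minpolyCoordMap_C k t c
  have hφ₁T : ∀ i, φ₁ (T₁ i) = 0 := fun i => by
    change φ₁ (algebraMap S₀ S₁ _) = 0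
    rw [hφ₁]; exact eval_minpolyCoord k t φ₀.toRingHom hφ₀B i
  have hφ₁R : ∀ r : R, φ₁ (algebraMap R S₁ r) = φ r := fun r => by
    rw [IsScalarTower.algebraMap_apply R S₀ S₁, hφ₁, hφ₀]
  -- `S₁` is a localization of `R` away from `h₁ = f₁ · d`
  obtain ⟨d, a, hloc₁, hd⟩ := exists_away_mul f₁ D S₁
  haveI := hloc₁
  have hφd : φ d ≠ 0 := by
    intro h0
    apply hDne
    have := congrArg φ₀ hd
    rw [hφ₀, h0, map_mul, map_pow, hφ₀] at this
    exact (mul_eq_zero.mp this.symm).resolve_right (pow_ne_zero a (hφne f₁ hf₁x))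
  have hh₁x : f₁ * d ∉ x := fun hx => (‹x.IsPrime›.mem_or_mem hx).elim hf₁x
    (fun hdx => hφd (by
      have : d ∈ RingHom.ker (φ : R →+* m) := hker ▸ hdx
      exact this))
  have hh₁0 : ((f₁ * d : R) : K) ≠ 0 := fun e => hh₁x (by
    have : f₁ * d = 0 := Subtype.ext e
    rw [this]; exact x.zero_mem)
  -- transport `S₁` to `Rh₁ = R[1/h₁] ⊆ K`
  let Rh₁ : Subalgebra k K := locAway R ((f₁ * d : R) : K) (f₁ * d).2
  letI algRh₁ : Algebra R Rh₁ :=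
    (Subalgebra.inclusion (le_locAway (B := R) (f := ((f₁ * d : R) : K)) (hf := (f₁ * d).2))).toRingHom.toAlgebra
  haveI : IsScalarTower k R Rh₁ := IsScalarTower.of_algebraMap_eq fun _ => rfl
  haveI : IsLocalization.Away (f₁ * d) Rh₁ :=
    isLocalization_locAway (B := R) (f := ((f₁ * d : R) : K)) (hf := (f₁ * d).2) hh₁0
  let e₁ : S₁ ≃ₐ[R] Rh₁ := IsLocalization.algEquiv (Submonoid.powers (f₁ * d)) S₁ Rh₁
  letI instB₁ : Algebra B Rh₁ := (e₁.toRingEquiv.toRingHom.comp ψ).toAlgebra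
  have hB₁ : ∀ q : B, algebraMap B Rh₁ q = e₁ (ψ q) := fun q => rfl
  haveI : Algebra.Etale B Rh₁ := RingHom.Etale.respectsIso.1 ψ e₁.toRingEquiv hψ
  haveI : IsScalarTower k B Rh₁ := IsScalarTower.of_algebraMap_eq fun c => by
    rw [hB₁, MvPolynomial.algebraMap_eq, hψC, IsScalarTower.algebraMap_apply k R S₁,
      AlgEquiv.commutes, ← IsScalarTower.algebraMap_apply]
  -- the point on `Rh₁`
  let φh₁ : Rh₁ →ₐ[k] m := (φ₁.comp (e₁.symm.toAlgHom.restrictScalars k))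
  have hφh₁e : ∀ z : S₁, φh₁ (e₁ z) = φ₁ z := fun z => by
    change φ₁ (e₁.symm (e₁ z)) = φ₁ z
    rw [AlgEquiv.symm_apply_apply]
  have hφh₁R : ∀ r : R, φh₁ (algebraMap R Rh₁ r) = φ r := fun r => by
    rw [← e₁.commutes r, hφh₁e, hφ₁R]
  let q : Ideal Rh₁ := RingHom.ker (φh₁ : Rh₁ →+* m)
  haveI hq : q.IsPrime := RingHom.ker_isPrime _
  -- Step 6: standard étale neighbourhood for the new coordinates
  obtain ⟨f₂, hf₂q, hstd₂⟩ := Algebra.IsEtaleAt.exists_isStandardEtale (R := B) (S := Rh₁) q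
  haveI := hstd₂
  let S₂ := Localization.Away f₂
  obtain ⟨r₂, a₂, hloc₂, hr₂⟩ := exists_away_mul (f₁ * d) f₂ S₂
  haveI := hloc₂
  have hf₂q' : φh₁ f₂ ≠ 0 := fun h0 => hf₂q h0
  have hφr₂ : φ r₂ ≠ 0 := by
    have := congrArg φh₁ hr₂
    rw [hφh₁R, map_mul, map_pow, hφh₁R] at this
    rw [this]
    exact mul_ne_zero hf₂q' (pow_ne_zero _ (hφne _ hh₁x))
  -- Step 7: normalize the value of the denominator to `1`
  have hv : φ (f₁ * d * r₂) ≠ 0 := by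
    rw [map_mul]; exact mul_ne_zero (hφne _ hh₁x) hφr₂
  obtain ⟨r₄, hr₄⟩ := hφ (φ (f₁ * d * r₂))⁻¹
  have hφh : φ (f₁ * d * r₂ * r₄) = 1 := by
    rw [map_mul, hr₄, mul_inv_cancel₀ hv]
  let S₃ := Localization.Away (algebraMap R S₂ r₄)
  haveI : Algebra.IsStandardEtale B S₃ :=
    Algebra.IsStandardEtale.of_isLocalizationAway (algebraMap R S₂ r₄)
  haveI : IsLocalization.Away (f₁ * d * r₂ * r₄) S₃ := inferInstance
  -- Step 8: transport to `Rh = R[1/h] ⊆ K`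
  set h : R := f₁ * d * r₂ * r₄ with hhdef
  have hhx : h ∉ x := fun hx => by
    have := hmemx h |>.mt
    exact absurd hx (fun hx' => one_ne_zero (hφh ▸ (show φ h = 0 from by
      have : h ∈ RingHom.ker (φ : R →+* m) := hker ▸ hx'; exact this)))
  have hh0 : (h : K) ≠ 0 := fun e => hhx (by
    have : h = 0 := Subtype.ext e
    rw [this]; exact x.zero_mem)
  let Rh : Subalgebra k K := locAway R (h : K) h.2
  letI algRh : Algebra R Rh :=
    (Subalgebra.inclusion (le_locAway (B := R) (f := (h : K)) (hf := h.2))).toRingHom.toAlgebra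
  haveI : IsScalarTower k R Rh := IsScalarTower.of_algebraMap_eq fun _ => rfl
  haveI : IsLocalization.Away h Rh := isLocalization_locAway (B := R) (f := (h : K)) (hf := h.2) hh0
  let e : S₃ ≃ₐ[R] Rh := IsLocalization.algEquiv (Submonoid.powers h) S₃ Rh
  letI instB : Algebra B Rh := (e.toRingEquiv.toRingHom.comp (algebraMap B S₃)).toAlgebra
  have hB : ∀ b : B, algebraMap B Rh b = e (algebraMap B S₃ b) := fun b => rfl
  let e' : S₃ ≃ₐ[B] Rh := AlgEquiv.ofRingEquiv (f := e.toRingEquiv) (fun b => (hB b).symm)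
  have hstdRh : Algebra.IsStandardEtale B Rh := Algebra.IsStandardEtale.of_equiv e'
  -- the coordinates in `K`
  let χ : S₁ →ₐ[R] Rh := e.toAlgHom.comp ((IsScalarTower.toAlgHom R S₂ S₃).comp
    ((IsScalarTower.toAlgHom R Rh₁ S₂).comp e₁.toAlgHom))
  have hχB : ∀ b : B, algebraMap B Rh b = χ (ψ b) := fun b => by
    rw [hB, IsScalarTower.algebraMap_apply B S₂ S₃, IsScalarTower.algebraMap_apply B Rh₁ S₂, hB₁]
    rfl
  let T : Fin n → K := fun i => (χ (T₁ i) : K)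
  have hT : ∀ i, T i ∈ Rh := fun i => (χ (T₁ i)).2
  have hTsub : ∀ i, (⟨T i, hT i⟩ : Rh) = χ (T₁ i) := fun i => rfl
  -- the point on `Rh`
  have hhu : IsUnit (φ h) := by rw [hφh]; exact isUnit_one
  let φh : Rh →ₐ[k] m := IsLocalization.Away.liftAlgHom h (f := φ) hhu
  have hφhR : ∀ r : R, φh (algebraMap R Rh r) = φ r := fun r => IsLocalization.Away.lift_eq h hhu r
  have hφhχ : ∀ z : S₁, φh (χ z) = φ₁ z := by
    intro z
    have : (φh : Rh →+* m).comp χ.toRingHom = (φ₁ : S₁ →+* m) := by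
      refine IsLocalization.ringHom_ext (Submonoid.powers (f₁ * d)) ?_
      ext r
      simp only [RingHom.comp_apply, AlgHom.toRingHom_eq_coe, AlgHom.coe_toRingHom,
        AlgHom.commutes]
      rw [hφhR, hφ₁R]
    exact congr($this z)
  refine ⟨h, h.2, ?_, φh, ?_, n, T, hT, ?_, ?_⟩
  · exact hφh
  · intro r hr
    have : (⟨(r : K), hr⟩ : Rh) = algebraMap R Rh r := rfl
    rw [this, hφhR]
  · intro i
    rw [hTsub, hφhχ, hφ₁T]
  · -- the constructed structure is `Xᵢ ↦ Tᵢ`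
    have hinst : (MvPolynomial.aeval (R := k) (fun i => (⟨T i, hT i⟩ : Rh))).toAlgebra = instB := by
      refine Algebra.algebra_ext _ _ fun b => ?_
      change (MvPolynomial.aeval (R := k) (fun i => (⟨T i, hT i⟩ : Rh))) b = algebraMap B Rh b
      have : MvPolynomial.aeval (R := k) (fun i => (⟨T i, hT i⟩ : Rh)) =
          (χ.restrictScalars k).comp ((minpolyCoordMapₐ (S₀ := S₀) k t)) := by
        refine MvPolynomial.algHom_ext fun i => ?_
        rw [MvPolynomial.aeval_X, hTsub]
        change _ = χ (ψ (MvPolynomial.X i))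
        rw [hψX]
      rw [this, hχB]
      rfl
    rw [hinst]
    exact hstdRh

end Literature.AlgebraicGeometry.Resolution
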